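import Mathlib
import Literature.Computability.AlgebraicComplexity.GroupTheoreticMatMul
import HarnessLib

/-!
# STPP families of punctured lines: diagonal patterns, packing, hyperplane packing

Topic `Literature/Computability/AlgebraicComplexity` (sub-namespace `LineSTPP`).  For a family of
punctured-line triples `A_i = F^× a_i`, `B_i = F^× b_i`, `C_i = F^× c_i` in `F^m` (`F` a finite
field, `a_i, b_i, c_i ≠ 0`, memberships `v ∈ A_i ↔ v ≠ 0 ∧ ∃ t, v = t • a_i`, exactly as in the
route statements of `MatrixMultiplication/AlgebraicSTPPDichotomy`) satisfying the simultaneous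
triple product property `IsSTPP A B C` (Cohn–Kleinberg–Szegedy–Umans 2005, Def. 5.1, the tree's
additive form), we extract the four consequences that the cone Fourier bound (refutation of the
route crux `AlgebraicSTPPDichotomy.ExactLineDesign`, with `LineSTPPConeFourier.lean`) uses:

* `sol6` (all indices): a vanishing unit combination
  `x₀a_i + x₁b_i + x₂b_j + x₃c_j + x₄c_k + x₅a_k = 0` forces `i = j = k`, `x₅ = -x₀`, `x₂ = -x₁`,
  `x₄ = -x₃`;
* `sol4ab`, `sol4bc` (patterns `(i,i',i')`, `(j',j,j')`): two-block relations are diagonal;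
* `inj_ca` (pattern `(k',k',k)`): `(k, z, x) ↦ z c_k - x a_k` is injective, whence the packing bound
  `N (q-1)² ≤ q^m` (`packing`; Blasiak et al. 2017, Lemma 2.4 for this shape) and hyperplane packing
  `q (q-1)² · #{k : ξ ⊥ a_k, c_k} ≤ q^m` for `ξ ≠ 0` (`hyperplane_packing`, via
  `card_mul_card_hyperplane : q · #ξ^⊥ = q^m`).

## References
* H. Cohn, R. Kleinberg, B. Szegedy, C. Umans, *Group-theoretic algorithms for matrix
  multiplication*, FOCS 2005, arXiv:math/0511460, Def. 5.1. [CohnKleinbergSzegedyUmans2005]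
* J. Blasiak, T. Church, H. Cohn, J. A. Grochow, E. Naslund, W. F. Sawin, C. Umans, *On cap sets and
  the group-theoretic approach to matrix multiplication*, Discrete Analysis 2017:3, Lemma 2.4.
  [BlasiakChurchCohnGrochowNaslundSawinUmans2017]
-/

open Finset Matrix

namespace Literature.Computability.AlgebraicComplexity.LineSTPP

section Family

variable {F : Type*} [Field F] [Fintype F] [DecidableEq F] {m N : ℕ}
  {a b c : Fin N → Fin m → F} {A B C : Fin N → Finset (Fin m → F)}

/-! The hypotheses of an STPP family of punctured-line triples, as produced by `ExactLineDesign`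
(kept as explicit section hypotheses `hne hA hB hC hS`). -/
variable (hne : ∀ i, a i ≠ 0 ∧ b i ≠ 0 ∧ c i ≠ 0)
  (hA : ∀ i v, v ∈ A i ↔ v ≠ 0 ∧ ∃ t : F, v = t • a i)
  (hB : ∀ i v, v ∈ B i ↔ v ≠ 0 ∧ ∃ t : F, v = t • b i)
  (hC : ∀ i v, v ∈ C i ↔ v ≠ 0 ∧ ∃ t : F, v = t • c i)
  (hS : Literature.Computability.AlgebraicComplexity.IsSTPP A B C)

omit [Fintype F] [DecidableEq F] in
/-- Unit multiples of the generator lie in the punctured line. [folklore] -/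
theorem units_smul_mem {v : Fin m → F} (hv : v ≠ 0) {S : Finset (Fin m → F)}
    (hS : ∀ w, w ∈ S ↔ w ≠ 0 ∧ ∃ t : F, w = t • v) (t : Fˣ) : (t : F) • v ∈ S :=
  (hS _).2 ⟨smul_ne_zero t.ne_zero hv, t, rfl⟩

omit [Fintype F] [DecidableEq F] in
/-- Negated unit multiples of the generator lie in the punctured line. [folklore] -/
theorem neg_units_smul_mem {v : Fin m → F} (hv : v ≠ 0) {S : Finset (Fin m → F)}
    (hS : ∀ w, w ∈ S ↔ w ≠ 0 ∧ ∃ t : F, w = t • v) (t : Fˣ) : -((t : F) • v) ∈ S := by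
  have := units_smul_mem hv hS (-t)
  rwa [Units.val_neg, neg_smul] at this

omit [Fintype F] [DecidableEq F] in
/-- The generator lies in its punctured line. [folklore] -/
theorem self_mem {v : Fin m → F} (hv : v ≠ 0) {S : Finset (Fin m → F)}
    (hS : ∀ w, w ∈ S ↔ w ≠ 0 ∧ ∃ t : F, w = t • v) : v ∈ S :=
  (hS _).2 ⟨hv, 1, (one_smul _ _).symm⟩

omit [Fintype F] [DecidableEq F] in
/-- Cancelling a non-zero vector: `x • v = y • v → x = y`. [folklore] -/
theorem units_eq_of_smul_eq {v : Fin m → F} (hv : v ≠ 0) {x y : Fˣ}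
    (hxy : (x : F) • v = (y : F) • v) : x = y := by
  have h0 : ((x : F) - y) • v = 0 := by rw [sub_smul, hxy, sub_self]
  exact Units.ext (sub_eq_zero.1 ((smul_eq_zero.1 h0).resolve_right hv))

omit [Fintype F] [DecidableEq F] in
/-- Cancelling a non-zero vector: `-(y • v) = x • v → y = -x`. [folklore] -/
theorem units_eq_neg_of_smul_eq {v : Fin m → F} (hv : v ≠ 0) {x y : Fˣ}
    (hxy : -((y : F) • v) = (x : F) • v) : y = -x := by
  have h0 : ((x : F) + y) • v = 0 := by rw [add_smul, ← hxy, neg_add_cancel]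
  have h1 : (x : F) + y = 0 := (smul_eq_zero.1 h0).resolve_right hv
  exact Units.ext (by rw [Units.val_neg]; exact eq_neg_of_add_eq_zero_right h1)

omit [Fintype F] [DecidableEq F] in
include hne hA hB hC hS in
/-- STPP, all-index pattern: a vanishing unit combination
`x₀ a_i + x₁ b_i + x₂ b_j + x₃ c_j + x₄ c_k + x₅ a_k = 0` is diagonal. [folklore] -/
theorem sol6 {i j k : Fin N} {x₀ x₁ x₂ x₃ x₄ x₅ : Fˣ}
    (H : (x₀ : F) • a i + (x₁ : F) • b i + (x₂ : F) • b j + (x₃ : F) • c j + (x₄ : F) • c k +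
      (x₅ : F) • a k = 0) :
    i = j ∧ j = k ∧ x₅ = -x₀ ∧ x₂ = -x₁ ∧ x₄ = -x₃ := by
  obtain ⟨hij, hjk, hs, ht, hu⟩ := hS i j k
    (-((x₅ : F) • a k)) (neg_units_smul_mem (hne k).1 (hA k) x₅)
    ((x₀ : F) • a i) (units_smul_mem (hne i).1 (hA i) x₀)
    (-((x₁ : F) • b i)) (neg_units_smul_mem (hne i).2.1 (hB i) x₁)
    ((x₂ : F) • b j) (units_smul_mem (hne j).2.1 (hB j) x₂)
    (-((x₃ : F) • c j)) (neg_units_smul_mem (hne j).2.2 (hC j) x₃)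
    ((x₄ : F) • c k) (units_smul_mem (hne k).2.2 (hC k) x₄)
    (by rw [← H]; module)
  subst hij; subst hjk
  exact ⟨rfl, rfl, units_eq_neg_of_smul_eq (hne i).1 hs,
    (units_eq_neg_of_smul_eq (hne i).2.1 ht).symm ▸ (neg_neg x₂).symm ▸ rfl,
    (units_eq_neg_of_smul_eq (hne i).2.2 hu).symm ▸ (neg_neg x₄).symm ▸ rfl⟩

omit [Fintype F] [DecidableEq F] in
include hne hA hB hC hS in
/-- STPP, pattern `(i, i', i')`: `x₀ a_i + x₁ b_i + x₂ a_i' + x₃ b_i' = 0` is diagonal. [folklore] -/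
theorem sol4ab {i i' : Fin N} {x₀ x₁ x₂ x₃ : Fˣ}
    (H : (x₀ : F) • a i + (x₁ : F) • b i + (x₂ : F) • a i' + (x₃ : F) • b i' = 0) :
    i = i' ∧ x₂ = -x₀ ∧ x₃ = -x₁ := by
  obtain ⟨hii, -, hs, ht, -⟩ := hS i i' i'
    (-((x₂ : F) • a i')) (neg_units_smul_mem (hne i').1 (hA i') x₂)
    ((x₀ : F) • a i) (units_smul_mem (hne i).1 (hA i) x₀)
    (-((x₁ : F) • b i)) (neg_units_smul_mem (hne i).2.1 (hB i) x₁)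
    ((x₃ : F) • b i') (units_smul_mem (hne i').2.1 (hB i') x₃)
    (c i') (self_mem (hne i').2.2 (hC i'))
    (c i') (self_mem (hne i').2.2 (hC i'))
    (by rw [← H]; module)
  subst hii
  exact ⟨rfl, units_eq_neg_of_smul_eq (hne i).1 hs,
    (units_eq_neg_of_smul_eq (hne i).2.1 ht).symm ▸ (neg_neg x₃).symm ▸ rfl⟩

omit [Fintype F] [DecidableEq F] in
include hne hA hB hC hS in
/-- STPP, pattern `(j', j, j')`: `x₀ b_j + x₁ c_j + x₂ b_j' + x₃ c_j' = 0` is diagonal. [folklore] -/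
theorem sol4bc {j j' : Fin N} {x₀ x₁ x₂ x₃ : Fˣ}
    (H : (x₀ : F) • b j + (x₁ : F) • c j + (x₂ : F) • b j' + (x₃ : F) • c j' = 0) :
    j = j' ∧ x₂ = -x₀ ∧ x₃ = -x₁ := by
  obtain ⟨hjj, -, -, ht, hu⟩ := hS j' j j'
    (a j') (self_mem (hne j').1 (hA j'))
    (a j') (self_mem (hne j').1 (hA j'))
    (-((x₂ : F) • b j')) (neg_units_smul_mem (hne j').2.1 (hB j') x₂)
    ((x₀ : F) • b j) (units_smul_mem (hne j).2.1 (hB j) x₀)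
    (-((x₁ : F) • c j)) (neg_units_smul_mem (hne j).2.2 (hC j) x₁)
    ((x₃ : F) • c j') (units_smul_mem (hne j').2.2 (hC j') x₃)
    (by rw [← H]; module)
  subst hjj
  exact ⟨rfl, units_eq_neg_of_smul_eq (hne j').2.1 ht,
    (units_eq_neg_of_smul_eq (hne j').2.2 hu).symm ▸ (neg_neg x₃).symm ▸ rfl⟩

omit [Fintype F] [DecidableEq F] in
include hne hA hB hC hS in
/-- STPP, pattern `(k', k', k)`: the map `(k, z, x) ↦ z c_k − x a_k` is injective. [folklore] -/
theorem inj_ca {k k' : Fin N} {z x z' x' : Fˣ}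
    (H : (z : F) • c k - (x : F) • a k = (z' : F) • c k' - (x' : F) • a k') :
    k = k' ∧ z = z' ∧ x = x' := by
  obtain ⟨-, hkk, hs, -, hu⟩ := hS k' k' k
    ((x : F) • a k) (units_smul_mem (hne k).1 (hA k) x)
    ((x' : F) • a k') (units_smul_mem (hne k').1 (hA k') x')
    (b k') (self_mem (hne k').2.1 (hB k'))
    (b k') (self_mem (hne k').2.1 (hB k'))
    ((z' : F) • c k') (units_smul_mem (hne k').2.2 (hC k') z')
    ((z : F) • c k) (units_smul_mem (hne k).2.2 (hC k) z)
    (by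
      have H' : (z : F) • c k - (x : F) • a k - ((z' : F) • c k' - (x' : F) • a k') = 0 :=
        sub_eq_zero.2 H
      rw [sub_self, add_zero, ← H']
      abel)
  subst hkk
  exact ⟨rfl, (units_eq_of_smul_eq (hne k').2.2 hu).symm, units_eq_of_smul_eq (hne k').1 hs⟩

/-- The packing map `(k, z, x) ↦ z c_k − x a_k`. [folklore] -/
def packMap (a c : Fin N → Fin m → F) (p : Fin N × Fˣ × Fˣ) : Fin m → F :=
  (p.2.1 : F) • c p.1 - (p.2.2 : F) • a p.1

omit [Fintype F] [DecidableEq F] in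
include hne hA hB hC hS in
/-- `packMap` is injective on an STPP line family. [folklore] -/
theorem packMap_injective : Function.Injective (packMap a c) := by
  rintro ⟨k, z, x⟩ ⟨k', z', x'⟩ H
  obtain ⟨rfl, rfl, rfl⟩ := inj_ca hne hA hB hC hS H
  rfl

include hne hA hB hC hS in
/-- Packing: `N (q-1)^2 ≤ q^m`. [folklore] -/
theorem packing :
    N * ((Fintype.card F - 1) * (Fintype.card F - 1)) ≤ Fintype.card F ^ m := by
  have := Fintype.card_le_of_injective _ (packMap_injective hne hA hB hC hS)
  simpa [Fintype.card_prod, Fintype.card_fin, Fintype.card_units, Fintype.card_pi] using this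

/-- All fibres of `v ↦ ξ ⬝ᵥ v` (`ξ ≠ 0`) have `q^{m-1}` elements: `q · #(ξ^⊥) = q^m`. [folklore] -/
theorem card_mul_card_hyperplane {ξ : Fin m → F} (hξ : ξ ≠ 0) :
    Fintype.card F * (univ.filter fun v : Fin m → F => ξ ⬝ᵥ v = 0).card = Fintype.card F ^ m := by
  obtain ⟨l, hl⟩ : ∃ l, ξ l ≠ 0 := by
    by_contra h0
    push Not at h0
    exact hξ (funext h0)
  have hfib : ∀ r : F, (univ.filter fun v : Fin m → F => ξ ⬝ᵥ v = r).card =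
      (univ.filter fun v : Fin m → F => ξ ⬝ᵥ v = 0).card := by
    intro r
    symm
    refine Finset.card_equiv (Equiv.addRight (Pi.single l (r / ξ l))) fun v => ?_
    simp only [Finset.mem_filter, Finset.mem_univ, true_and, Equiv.coe_addRight, dotProduct_add,
      dotProduct_single, mul_div_cancel₀ _ hl]
    constructor
    · intro hv; rw [hv, zero_add]
    · intro hv; linear_combination hv
  have htot := Finset.card_eq_sum_card_fiberwise (s := (univ : Finset (Fin m → F)))
    (t := (univ : Finset F)) (f := fun v => ξ ⬝ᵥ v) (fun _ _ => Finset.mem_coe.2 (Finset.mem_univ _))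
  simp only [hfib, Finset.sum_const, Finset.card_univ, smul_eq_mul, Fintype.card_pi,
    Finset.prod_const, Fintype.card_fin] at htot
  exact htot.symm

/-- The blocks whose `(c_k, a_k)`-plane lies in the hyperplane `ξ^⊥`. [folklore] -/
def Kset (a c : Fin N → Fin m → F) (ξ : Fin m → F) : Finset (Fin N) :=
  univ.filter fun k => ξ ⬝ᵥ c k = 0 ∧ ξ ⬝ᵥ a k = 0

include hne hA hB hC hS in
/-- Hyperplane packing: `q (q-1)^2 · #Kset(ξ) ≤ q^m` for `ξ ≠ 0`. [folklore] -/
theorem hyperplane_packing {ξ : Fin m → F} (hξ : ξ ≠ 0) :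
    Fintype.card F * ((Kset a c ξ).card * ((Fintype.card F - 1) * (Fintype.card F - 1))) ≤
      Fintype.card F ^ m := by
  rw [← card_mul_card_hyperplane hξ]
  apply Nat.mul_le_mul_left
  have hmaps : Set.MapsTo (packMap a c)
      ((Kset a c ξ ×ˢ ((univ : Finset Fˣ) ×ˢ (univ : Finset Fˣ)) : Finset _) : Set _)
      ((univ.filter fun v : Fin m → F => ξ ⬝ᵥ v = 0 : Finset _) : Set _) := by
    rintro ⟨k, z, x⟩ hk
    simp only [Finset.coe_product, Finset.coe_univ, Set.mem_prod, Finset.mem_coe, Kset,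
      Finset.mem_filter, Finset.mem_univ, true_and, Set.mem_univ, and_true] at hk
    simp only [Finset.coe_filter, Finset.mem_univ, true_and, Set.mem_setOf_eq, packMap,
      dotProduct_sub, dotProduct_smul, smul_eq_mul, hk.1, hk.2, mul_zero, sub_zero]
  have := Finset.card_le_card_of_injOn (packMap a c) hmaps
    ((packMap_injective hne hA hB hC hS).injOn)
  simpa [Finset.card_product, Fintype.card_units] using this

end Family

end Literature.Computability.AlgebraicComplexity.LineSTPP
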